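/-
Copyright (c) 2026 the pub-hodgecm-mathlib formalisation cell (harness21).  Prover seat hodgecm-mathlib-K2Liu-p09 (g0): Track B «K2-LIT»,
#184♮ = hLiu418 = stmt-HodgeConjecture-24832, file #9 of the K2_Liu road (socket module
`Cruxes/HLiu418/Lines/K2_Liu_CurveThetaSigs_U3a_SiegelEisenstein.lean` feca6d8e9697719e), organ (III-a), generic half; 2026-09-03.
-/
import Literature.NumberTheory.GelbartRogawski1991.DoubledUnitarySiegelParabolicAlgebra   -- ★ `blk_mul`, `isUnit_detDelta_of_isSiegelDelta`
import Literature.NumberTheory.Automorphic.AdelicVectorHeightBound                       -- ★ `matHeightBound`, `one_le_matHeightBound_mul_vecHeight`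
import Literature.NumberTheory.Automorphic.AdelicHeightZetaUniform                        -- ★ `exists_matHeightBound_le_of_isCompact`
import Literature.LinearAlgebra.Matrix.SylvesterFranke                                    -- ★ `compound`, `compound_mul` (Binet–Cauchy)
import HarnessLib

/-!
# Crux `HLiu418`, Track B road `K2_Liu`, unit U3a «SIEGEL EISENSTEIN SERIES», file #9 — helper 3a (organ (III-a), generic half):
# compounds of the annihilator frame `R₀ = (1 | −1)` of `Δ` and Godement's height bounds for Plücker vectors `ξ · g^{(k)}`

Cell `hodgecm-mathlib`, crux item hLiu418 = `stmt-HodgeConjecture-24832`, route of record `HCCMUnconditional`; squad K2 ∕ K2Liu,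
prover K2Liu-p09 (g0).  THEOREMS ONLY (no `def`, no instance, no notation, no named-fact hypothesis, no `sorry`); lane
`--supports stmt-HodgeConjecture-24832` (count-neutral; consumed by the sequel `K2LiuSiegelDoubledPluckerHeight`, the height `Φ` of ★
`K2LiuSiegelEisensteinDoubledSummableReduction.summable_norm_translate_of_iwasawa_of_height` toward socket #9
`sig_K2LiuSiegelEisensteinDoubledSummable`).

* §1 `fromCols_one_neg_one_mul` — for `M₁₁ + M₁₂ = M₂₁ + M₂₂` (★ `IsSiegelDelta`): `(1 | −1) · M = (M₂₂ − M₁₂) · (1 | −1)` (the rows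
  `(e_i, −e_i)` span the annihilator of `Δ = {(x, x)}`, preserved by `P_Δ`); `(1 | −1)(1 ; 0) = 1`.
* §2 compounds (★ `Literature.LinearAlgebra.Matrix.compound`, Binet–Cauchy ★ `compound_mul`): the top compound of a square matrix is
  `det` (`compound_apply_of_card_eq`), `((D M)^{(n)})_{I,J} = det D · (M^{(n)})_{I,J}` (`compound_mul_apply_of_card_eq`), rows of
  `A^{(k)}` are non-zero when `A` has a right inverse, `compound` is continuous; and Godement's bounds for Plücker vectors
  `ξ · g^{(k)}`, `ξ` rational non-zero, `g ∈ GL_N(𝔸_K)`: `1 ≤ H((g⁻¹)^{(k)}) · h(ξ g^{(k)})` (★ `one_le_matHeightBound_mul_vecHeight`),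
  `h(ξ g^{(k)}) ≤ H(g^{(k)}) h(ξ)` (★ `vecHeight_vecMul_le`), finiteness, and `H(g^{(k)}), H((g⁻¹)^{(k)})` bounded on compacta
  (★ `exists_matHeightBound_le_of_isCompact`).
* §3 the frame re-enumerated along ★ `e₂ : Fin n ⊕ Fin n ≃ Fin (n + n)`: `R₀ · M = D_M · R₀` (`frame_mul_of_siegel`), right inverse,
  compatibility with `map`.

HONEST LABEL.  Count-neutral helper of the K2_Liu road; it retires nothing by itself: `HC_CM` is proved only modulo the 7 printed
citations (2 remaining named inputs: hLiu418 = `stmt-HodgeConjecture-24832`, h413 = `stmt-HodgeConjecture-24833`) until rung 0 closes.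

## References
* [Garrett2018] P. Garrett, *Modern Analysis of Automorphic Forms by Example* (2018), §2.2 Thm. 2.2.2, Cor. 3.3.3, §3.10.
* [Godement1964] R. Godement, *Domaines fondamentaux des groupes arithmétiques*, Sém. Bourbaki 257 (1962/63), §1.1 (heights).
* [Bernstein2009] D. S. Bernstein, *Matrix Mathematics* (2009), Fact 7.5.17 (compounds, Binet–Cauchy).
* [Liu2021] Y. Liu, Camb. J. Math. 9 (2021), App. B §B.3 p. 101.
-/

set_option autoImplicit false
-- the mandated namespace repeats the single-problem summit's segment (`HodgeConjecture.HodgeConjecture`)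
set_option linter.dupNamespace false

noncomputable section

open scoped Matrix NNReal
open NumberField IsDedekindDomain

namespace Summit.HodgeConjecture.HodgeConjecture.Cruxes.HLiu418.K2LiuSiegelDoubledPluckerFrame

open Literature.NumberTheory.Automorphic Literature.NumberTheory.Automorphic.UnitaryGroup
open Literature.NumberTheory.GelbartRogawski1991 Literature.NumberTheory.GelbartRogawski1991.GRConstruction
open Literature.LinearAlgebra.Matrix

/-! ## §1 The annihilator frame `R₀ = (1 | −1)` of `Δ` and the Siegel parabolic -/

section Blocks

variable {R : Type*} [CommRing R] {ι : Type*} [Fintype ι] [DecidableEq ι]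

/-- **`R₀ · p = D_p · R₀` on the Siegel parabolic**: for `M = [[M₁₁, M₁₂], [M₂₁, M₂₂]]` with `M₁₁ + M₁₂ = M₂₁ + M₂₂` (★
`IsSiegelDelta`), `(1 | −1) · M = (M₂₂ − M₁₂) · (1 | −1)` — the rows `(e_i, −e_i)` span the annihilator of `Δ = {(x, x)}`, which
`P_Δ` preserves. [cite: Garrett2018, §3.10] [cite: Liu2021, §B.3 p. 101] -/
theorem fromCols_one_neg_one_mul {M : Matrix (ι ⊕ ι) (ι ⊕ ι) R}
    (hS : M.toBlocks₁₁ + M.toBlocks₁₂ = M.toBlocks₂₁ + M.toBlocks₂₂) :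
    (Matrix.fromCols (1 : Matrix ι ι R) (-(1 : Matrix ι ι R)) : Matrix ι (ι ⊕ ι) R) * M =
      (M.toBlocks₂₂ - M.toBlocks₁₂) * (Matrix.fromCols (1 : Matrix ι ι R) (-(1 : Matrix ι ι R)) : Matrix ι (ι ⊕ ι) R) := by
  have hM := Matrix.fromBlocks_toBlocks M
  have hL : (Matrix.fromCols (1 : Matrix ι ι R) (-(1 : Matrix ι ι R)) : Matrix ι (ι ⊕ ι) R) * M =
      Matrix.fromCols (M.toBlocks₁₁ - M.toBlocks₂₁) (M.toBlocks₁₂ - M.toBlocks₂₂) := by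
    conv_lhs => rw [← hM]
    rw [Matrix.fromCols_mul_fromBlocks, Matrix.one_mul, Matrix.one_mul, Matrix.neg_mul, Matrix.neg_mul, Matrix.one_mul,
      Matrix.one_mul, ← sub_eq_add_neg, ← sub_eq_add_neg]
  have hR : (M.toBlocks₂₂ - M.toBlocks₁₂) * (Matrix.fromCols (1 : Matrix ι ι R) (-(1 : Matrix ι ι R)) : Matrix ι (ι ⊕ ι) R) =
      Matrix.fromCols (M.toBlocks₂₂ - M.toBlocks₁₂) (-(M.toBlocks₂₂ - M.toBlocks₁₂)) := by
    rw [Matrix.mul_fromCols, Matrix.mul_neg, Matrix.mul_one]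
  have h1 : M.toBlocks₁₁ - M.toBlocks₂₁ = M.toBlocks₂₂ - M.toBlocks₁₂ := by
    rw [sub_eq_sub_iff_add_eq_add, hS, add_comm]
  have h2 : M.toBlocks₁₂ - M.toBlocks₂₂ = -(M.toBlocks₂₂ - M.toBlocks₁₂) := by abel
  rw [hL, hR, h1, h2]

/-- `(1 | −1) · (1 ; 0) = 1`: a right inverse of `R₀`. [folklore] -/
theorem fromCols_one_neg_one_mul_fromRows :
    (Matrix.fromCols (1 : Matrix ι ι R) (-(1 : Matrix ι ι R)) : Matrix ι (ι ⊕ ι) R) *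
      (Matrix.fromRows (1 : Matrix ι ι R) (0 : Matrix ι ι R) : Matrix (ι ⊕ ι) ι R) = 1 := by
  rw [Matrix.fromCols_mul_fromRows, Matrix.one_mul, Matrix.mul_zero, add_zero]

end Blocks

/-! ## §2 Compounds and Godement heights on `GL_N(𝔸_K)` -/

section Compound

variable {R : Type*} [CommRing R] {m : Type*} [LinearOrder m] [Fintype m] {N k : ℕ}

omit [LinearOrder m] in
/-- Two `n`-element subsets of an `n`-element index type coincide (the row index of the top compound is a point). [folklore] -/
theorem powersetCard_eq_of_card_eq (hm : Fintype.card m = k) (I J : Set.powersetCard m k) : I = J := by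
  apply Subtype.ext
  rw [Finset.eq_univ_of_card _ ((Set.powersetCard.card_eq I).trans hm.symm),
    Finset.eq_univ_of_card _ ((Set.powersetCard.card_eq J).trans hm.symm)]

/-- The top compound of a square matrix is its determinant: `(D^{(n)})_{I,I} = det D` (`n = |index|`). [cite: Bernstein2009, Fact 7.5.17 (xii)] -/
theorem compound_apply_of_card_eq (hm : Fintype.card m = k) (D : Matrix m m R) (I J : Set.powersetCard m k) :
    compound k D I J = D.det := by
  classical
  rw [powersetCard_eq_of_card_eq hm J I, compound_apply]
  have hbij : Function.Bijective (Set.powersetCard.ofFinEmbEquiv.symm I : Fin k → m) := by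
    rw [Fintype.bijective_iff_injective_and_card, Fintype.card_fin]
    exact ⟨(Set.powersetCard.ofFinEmbEquiv.symm I).injective, hm.symm⟩
  exact Matrix.det_submatrix_equiv_self (Equiv.ofBijective _ hbij) D

/-- Row `I` of a product of compounds with a top compound on the left: `((D M)^{(n)})_{I,J} = det D · (M^{(n)})_{I,J}` when the
row index type of `D` has exactly `n` elements (Binet–Cauchy ★ `compound_mul`). [cite: Bernstein2009, Fact 7.5.17 (vi)] -/
theorem compound_mul_apply_of_card_eq {p : Type*} [LinearOrder p] [Fintype p] (hm : Fintype.card m = k)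
    (D : Matrix m m R) (M : Matrix m p R) (I : Set.powersetCard m k) (J : Set.powersetCard p k) :
    compound k (D * M) I J = D.det * compound k M I J := by
  rw [compound_mul, Matrix.mul_apply, Finset.sum_eq_single I]
  · rw [compound_apply_of_card_eq hm]
  · intro I' _ hI'
    exact absurd (powersetCard_eq_of_card_eq hm I' I) hI'
  · intro h
    exact absurd (Finset.mem_univ I) h

/-- A row of `A^{(k)}` is non-zero if `A` has a right inverse (`A B = 1 ⟹ A^{(k)} B^{(k)} = 1`). [cite: Bernstein2009, Fact 7.5.17 (vi)] -/
theorem compound_row_ne_zero {p : Type*} [LinearOrder p] [Fintype p] [Nontrivial R] {A : Matrix m p R} {B : Matrix p m R}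
    (h : A * B = 1) (I : Set.powersetCard m k) : (fun J => compound k A I J) ≠ 0 := by
  classical
  intro h0
  have h1 : compound k A * compound k B = 1 := by rw [← compound_mul, h, compound_one]
  have h2 : (compound k A * compound k B) I I = 0 := by
    rw [Matrix.mul_apply]
    refine Finset.sum_eq_zero fun J _ => ?_
    rw [show compound k A I J = 0 from congr_fun h0 J, zero_mul]
  rw [h1, Matrix.one_apply_eq] at h2
  exact one_ne_zero h2

omit [Fintype m] in
/-- `compound` is continuous (its entries are minors, polynomial in the entries). [folklore] -/
theorem continuous_compound {p : Type*} [LinearOrder p] [Fintype p] [TopologicalSpace R] [IsTopologicalRing R] :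
    Continuous (fun A : Matrix m p R => compound k A) :=
  continuous_matrix fun _ _ => (continuous_id.matrix_submatrix _ _).matrix_det

end Compound

section Heights

variable (K : Type) [Field K] [NumberField K] {N k : ℕ}

/-- **The compound of an invertible adelic matrix is invertible** (`(g^{(k)})⁻¹ = (g⁻¹)^{(k)}`), as an element of `GL`.
[cite: Bernstein2009, Fact 7.5.17 (xvi)] -/
theorem exists_compoundGL (g : GL (Fin N) (AdeleRing (𝓞 K) K)) :
    ∃ G : GL (Set.powersetCard (Fin N) k) (AdeleRing (𝓞 K) K),
      (G : Matrix _ _ (AdeleRing (𝓞 K) K)) = compound k (g : Matrix (Fin N) (Fin N) (AdeleRing (𝓞 K) K)) ∧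
        ((G⁻¹ : GL (Set.powersetCard (Fin N) k) (AdeleRing (𝓞 K) K)) : Matrix _ _ (AdeleRing (𝓞 K) K)) =
          compound k ((g⁻¹ : GL (Fin N) (AdeleRing (𝓞 K) K)) : Matrix (Fin N) (Fin N) (AdeleRing (𝓞 K) K)) :=
  ⟨⟨compound k (g : Matrix (Fin N) (Fin N) (AdeleRing (𝓞 K) K)),
      compound k ((g⁻¹ : GL (Fin N) (AdeleRing (𝓞 K) K)) : Matrix (Fin N) (Fin N) (AdeleRing (𝓞 K) K)),
      compound_mul_compound_of_mul_eq_one (by rw [← Units.val_mul, mul_inv_cancel, Units.val_one]),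
      compound_mul_compound_of_mul_eq_one (by rw [← Units.val_mul, inv_mul_cancel, Units.val_one])⟩,
    rfl, rfl⟩

/-- **Godement's floor for Plücker vectors**: for a rational `ξ ≠ 0` and `g ∈ GL_N(𝔸_K)`,
`1 ≤ H((g⁻¹)^{(k)}) · h(ξ · g^{(k)})` (★ `one_le_matHeightBound_mul_vecHeight` at `g^{(k)} ∈ GL`). In particular the height is
positive. [cite: Garrett2018, Cor. 3.3.3 (PDF p. 163)] [cite: Godement1964, §1.1] -/
theorem one_le_matHeightBound_compound_inv_mul_vecHeight {ξ : Set.powersetCard (Fin N) k → K} (hξ : ξ ≠ 0)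
    (g : GL (Fin N) (AdeleRing (𝓞 K) K)) :
    1 ≤ matHeightBound K (compound k ((g⁻¹ : GL (Fin N) (AdeleRing (𝓞 K) K)) : Matrix (Fin N) (Fin N) (AdeleRing (𝓞 K) K))) *
      vecHeight K (principalVec K ξ ᵥ* compound k (g : Matrix (Fin N) (Fin N) (AdeleRing (𝓞 K) K))) := by
  obtain ⟨G, hG, hGi⟩ := exists_compoundGL K (k := k) g
  rw [← hG, ← hGi]
  exact one_le_matHeightBound_mul_vecHeight hξ G

/-- The Plücker height of a rational frame is positive. [cite: Garrett2018, Cor. 3.3.3 (PDF p. 163)] -/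
theorem vecHeight_principalVec_vecMul_compound_pos {ξ : Set.powersetCard (Fin N) k → K} (hξ : ξ ≠ 0)
    (g : GL (Fin N) (AdeleRing (𝓞 K) K)) :
    0 < vecHeight K (principalVec K ξ ᵥ* compound k (g : Matrix (Fin N) (Fin N) (AdeleRing (𝓞 K) K))) := by
  have h := one_le_matHeightBound_compound_inv_mul_vecHeight K hξ g
  refine pos_iff_ne_zero.2 fun h0 => ?_
  rw [h0, mul_zero] at h
  exact absurd h (not_le.2 zero_lt_one)

/-- **Upper bound**: `h(ξ · g^{(k)}) ≤ H(g^{(k)}) · h(ξ)` (★ `vecHeight_vecMul_le`). [cite: Garrett2018, Thm. 2.2.2 (PDF p. 82)] -/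
theorem vecHeight_principalVec_vecMul_compound_le {ξ : Set.powersetCard (Fin N) k → K} (hξ : ξ ≠ 0)
    (g : GL (Fin N) (AdeleRing (𝓞 K) K)) :
    vecHeight K (principalVec K ξ ᵥ* compound k (g : Matrix (Fin N) (Fin N) (AdeleRing (𝓞 K) K))) ≤
      matHeightBound K (compound k (g : Matrix (Fin N) (Fin N) (AdeleRing (𝓞 K) K))) * vecHeight K (principalVec K ξ) := by
  obtain ⟨G, hG, -⟩ := exists_compoundGL K (k := k) g
  rw [← hG]
  exact vecHeight_vecMul_le (isHeightFinite_principalVec hξ) (isHeightFinite_principalVec_vecMul hξ G)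

/-- The Plücker vector of a rational frame times `g` has finite height data. [cite: Garrett2018, §2.2 (PDF p. 82)] -/
theorem isHeightFinite_principalVec_vecMul_compound {ξ : Set.powersetCard (Fin N) k → K} (hξ : ξ ≠ 0)
    (g : GL (Fin N) (AdeleRing (𝓞 K) K)) :
    IsHeightFinite K (principalVec K ξ ᵥ* compound k (g : Matrix (Fin N) (Fin N) (AdeleRing (𝓞 K) K))) := by
  obtain ⟨G, hG, -⟩ := exists_compoundGL K (k := k) g
  rw [← hG]
  exact isHeightFinite_principalVec_vecMul hξ G

/-- **Godement's matrix height is bounded on compact sets of `GL_N(𝔸_K)`, for `g^{(k)}` and `(g⁻¹)^{(k)}` at once**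
(★ `exists_matHeightBound_le_of_isCompact` on the continuous images). [cite: Garrett2018, Thm. 2.2.2 (PDF p. 82)] -/
theorem exists_matHeightBound_compound_le_of_isCompact {C : Set (GL (Fin N) (AdeleRing (𝓞 K) K))} (hC : IsCompact C) :
    ∃ B : ℝ≥0, ∀ g ∈ C,
      matHeightBound K (compound k (g : Matrix (Fin N) (Fin N) (AdeleRing (𝓞 K) K))) ≤ B ∧
        matHeightBound K (compound k ((g⁻¹ : GL (Fin N) (AdeleRing (𝓞 K) K)) : Matrix (Fin N) (Fin N) (AdeleRing (𝓞 K) K))) ≤ B := by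
  have hc : Continuous fun g : GL (Fin N) (AdeleRing (𝓞 K) K) =>
      compound k (g : Matrix (Fin N) (Fin N) (AdeleRing (𝓞 K) K)) :=
    continuous_compound.comp Units.continuous_val
  obtain ⟨B₁, hB₁⟩ := exists_matHeightBound_le_of_isCompact K (hC.image hc)
  obtain ⟨B₂, hB₂⟩ := exists_matHeightBound_le_of_isCompact K ((hC.image continuous_inv).image hc)
  refine ⟨max B₁ B₂, fun g hg => ⟨(hB₁ _ ⟨g, hg, rfl⟩).trans (le_max_left _ _), (hB₂ _ ⟨g⁻¹, ⟨g, hg, rfl⟩, rfl⟩).trans (le_max_right _ _)⟩⟩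

end Heights

/-! ## §3 The re-enumerated frame `R₀ = (1 | −1) ∘ e₂⁻¹` on `Fin (n + n)` -/

section Frame

variable {R : Type*} [CommRing R] {n : ℕ}

/-- `(D · Y) ∘ e = D · (Y ∘ e)` for a column re-enumeration `e`. [folklore] -/
theorem mul_submatrix_id (D : Matrix (Fin n) (Fin n) R) {κ κ' : Type*} [Fintype κ] (Y : Matrix (Fin n) κ R) (e : κ' → κ) :
    (D * Y).submatrix id e = D * Y.submatrix id e := by
  ext i j
  simp [Matrix.mul_apply, Matrix.submatrix_apply]

/-- **`R₀ · M = D_M · R₀`** for `M` on `Fin (n + n)` whose `e₂`-blocks satisfy the Siegel relation `M₁₁ + M₁₂ = M₂₁ + M₂₂`, with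
`R₀ = (1 | −1) ∘ e₂⁻¹` and `D_M = M₂₂ − M₁₂`. [cite: Garrett2018, §3.10] [cite: Liu2021, §B.3 p. 101] -/
theorem frame_mul_of_siegel {M : Matrix (Fin (n + n)) (Fin (n + n)) R}
    (hS : (Matrix.reindex (e₂ (n := n)).symm (e₂ (n := n)).symm M).toBlocks₁₁ +
        (Matrix.reindex (e₂ (n := n)).symm (e₂ (n := n)).symm M).toBlocks₁₂ =
      (Matrix.reindex (e₂ (n := n)).symm (e₂ (n := n)).symm M).toBlocks₂₁ +
        (Matrix.reindex (e₂ (n := n)).symm (e₂ (n := n)).symm M).toBlocks₂₂) :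
    (Matrix.fromCols (1 : Matrix (Fin n) (Fin n) R) (-(1 : Matrix (Fin n) (Fin n) R)) : Matrix (Fin n) (Fin n ⊕ Fin n) R).submatrix
        id (e₂ (n := n)).symm * M =
      ((Matrix.reindex (e₂ (n := n)).symm (e₂ (n := n)).symm M).toBlocks₂₂ -
          (Matrix.reindex (e₂ (n := n)).symm (e₂ (n := n)).symm M).toBlocks₁₂) *
        (Matrix.fromCols (1 : Matrix (Fin n) (Fin n) R) (-(1 : Matrix (Fin n) (Fin n) R)) : Matrix (Fin n) (Fin n ⊕ Fin n) R).submatrix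
          id (e₂ (n := n)).symm := by
  set B := Matrix.reindex (e₂ (n := n)).symm (e₂ (n := n)).symm M with hB
  have hM : M = B.submatrix (e₂ (n := n)).symm (e₂ (n := n)).symm := by
    rw [hB, Matrix.reindex_apply, Equiv.symm_symm, Matrix.submatrix_submatrix, Equiv.self_comp_symm, Matrix.submatrix_id_id]
  conv_lhs => rw [hM]
  rw [Matrix.submatrix_mul_equiv, fromCols_one_neg_one_mul hS, mul_submatrix_id]

/-- `R₀` has the right inverse `(1 ; 0) ∘ e₂` (so its top compound has non-zero row). [folklore] -/
theorem frame_mul_coframe :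
    (Matrix.fromCols (1 : Matrix (Fin n) (Fin n) R) (-(1 : Matrix (Fin n) (Fin n) R)) : Matrix (Fin n) (Fin n ⊕ Fin n) R).submatrix
        id (e₂ (n := n)).symm *
      (Matrix.fromRows (1 : Matrix (Fin n) (Fin n) R) (0 : Matrix (Fin n) (Fin n) R) : Matrix (Fin n ⊕ Fin n) (Fin n) R).submatrix
        (e₂ (n := n)).symm id = 1 := by
  rw [Matrix.submatrix_mul_equiv, fromCols_one_neg_one_mul_fromRows, Matrix.submatrix_id_id]

/-- `R₀` is the base change of the same integer frame: it commutes with `map`. [folklore] -/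
theorem frame_map {S : Type*} [CommRing S] (f : R →+* S) :
    ((Matrix.fromCols (1 : Matrix (Fin n) (Fin n) R) (-(1 : Matrix (Fin n) (Fin n) R)) : Matrix (Fin n) (Fin n ⊕ Fin n) R).submatrix
        id (e₂ (n := n)).symm).map f =
      (Matrix.fromCols (1 : Matrix (Fin n) (Fin n) S) (-(1 : Matrix (Fin n) (Fin n) S)) : Matrix (Fin n) (Fin n ⊕ Fin n) S).submatrix
        id (e₂ (n := n)).symm := by
  rw [← Matrix.submatrix_map]
  congr 1
  ext i (j | j)
  · simp [Matrix.fromCols, Matrix.one_apply, apply_ite f]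
  · simp [Matrix.fromCols, Matrix.one_apply, apply_ite f]

/-- the row index of the top compound on `Fin n`. [folklore] -/
theorem card_fin_eq (n : ℕ) : Fintype.card (Fin n) = n := Fintype.card_fin n

end Frame

end Summit.HodgeConjecture.HodgeConjecture.Cruxes.HLiu418.K2LiuSiegelDoubledPluckerFrame

end
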